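import Literature.AlgebraicGeometry.HodgeTheory.GlobalInvariantCycles
import Literature.AlgebraicGeometry.HodgeTheory.AlgebraicClasses

/-!
# Route MarkmanPartnerTransport · crux `PicardThreeK3Squares` (stmt-HodgeConjecture-19652) —
# the statement `AlgebraicLocusClosed` of the registered line `cm-anchor-spread` (stub F3), one definition

The registered skeleton of the crux (`ledger skeleton check`, sha `39ba70b5986d…`, line `cm-anchor-spread`
r2, lead seat hodge-nonav-19652-p1 gen 0, 2026-08-27) declares six stubs; its stub F3 is
`stub_algebraicLocusClosed : AlgebraicLocusClosed`, where `AlgebraicLocusClosed` is a `Prop` defined INSIDE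
the skeleton file (a seat work file, never written to `Cruxes/PicardThreeK3Squares/Lines/`). The statement
was PROVED by the same lineage (gen 7) as the tree theorem
`Summit.HodgeConjecture.HodgeConjecture.Theorems.MarkmanPartnerTransport.AlgebraicLocusSpread.algebraicLocusClosed`
(file `…PicardThreeK3SquaresAlgebraicLocusSpread`, whose docstring records it as "literally the registered
body"). This file gives that body its registered NAME, so that the stub can be discharged by name
(`…PicardThreeK3SquaresStubAlgebraicLocusClosed`):

* `CmAnchorSpread.AlgebraicLocusClosed` — **spread of algebraicity from a Euclidean-open set of the base**:
  for a smooth projective family `g : 𝒳 → B` of relative dimension `n` with quasi-projective total space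
  over a smooth quasi-projective base whose space of complex points `B(ℂ)` is connected, and a global
  class `W ∈ H²ᵖ(𝒳(ℂ); ℂ)`, if `W|_{𝒳_b}` is algebraic (`∈ algebraicClasses (𝒳_b) p = Nᵖ H²ᵖ`) for every
  `b` in a non-empty open `U ⊆ B(ℂ)` (analytic topology), then `W|_{𝒳_b}` is algebraic for every
  `b ∈ B(ℂ)`. (Charles–Schnell Prop. 11.3.11 / Voisin II §3.3.1, §7.3.2: the algebraicity locus is a
  countable union of Zariski-closed algebraic subsets of the irreducible `B`, and a non-empty analytic open
  set is not covered by proper ones — Baire.)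

One definition, verbatim the statement of the tree theorem named above (binder for binder); nothing is
asserted here, no instance, no notation, no sorry. It is a THEOREM of the tree (not an open statement) and
is restated as a `def` only because the gate's stub matching is by name. Prover seat
leafhand-hodge-markmanpartnertran-1 (gen 0), `--supports stmt-HodgeConjecture-19652`. Nothing here proves
the crux or any instance of the Hodge conjecture.

References: F. Charles, C. Schnell, *Notes on absolute Hodge classes* (2014), Prop. 11.3.11; C. Voisin,
*Hodge Theory and Complex Algebraic Geometry II* (2003), §3.3.1 and §7.3.2.
-/

set_option linter.dupNamespace false

noncomputable section

namespace Summit.HodgeConjecture.HodgeConjecture.Theorems.MarkmanPartnerTransport.CmAnchorSpread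

open CategoryTheory AlgebraicGeometry
open Literature.AlgebraicGeometry Literature.AlgebraicGeometry.Motives Literature.AlgebraicGeometry.HodgeTheory

/-- **Stub F3 `AlgebraicLocusClosed` of line `cm-anchor-spread` (crux `PicardThreeK3Squares`,
stmt-HodgeConjecture-19652) — the statement.** For a smooth projective family `g : 𝒳 → B` of relative
dimension `n` (quasi-projective total space; smooth quasi-projective base with `B(ℂ)` connected) and a
global class `W ∈ H²ᵖ(𝒳(ℂ); ℂ)`: if `W|_{𝒳_b} ∈ algebraicClasses (𝒳_b) p` for all `b` in a non-empty
Euclidean-open `U ⊆ B(ℂ)`, then `W|_{𝒳_b} ∈ algebraicClasses (𝒳_b) p` for every `b ∈ B(ℂ)`. Verbatim the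
statement of the tree theorem `AlgebraicLocusSpread.algebraicLocusClosed` (which proves it; sources
Charles–Schnell 2014 Prop. 11.3.11 and Voisin II §3.3.1, §7.3.2 are cited THERE); defined here only to carry
the registered stub's name — a proved statement of the tree, not a vendored fact. -/
def AlgebraicLocusClosed : Prop :=
  ∀ (𝒳 B : SchemeOver ℂ) (g : 𝒳 ⟶ B) (n p : ℕ) (W : complexBetti 𝒳 (2 * p)),
    IsSmoothProjectiveFamily g n → IsQuasiProjectiveOver 𝒳 → IsQuasiProjectiveOver B →
    AlgebraicGeometry.Smooth B.hom → ConnectedSpace (ComplexPoints B) →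
    ∀ U : Set (ComplexPoints B), IsOpen U → U.Nonempty →
      (∀ b ∈ U, complexBetti.map (Motives.fiberι g b) (2 * p) W ∈ algebraicClasses (fiberOver g b) p) →
      ∀ b : ComplexPoints B,
        complexBetti.map (Motives.fiberι g b) (2 * p) W ∈ algebraicClasses (fiberOver g b) p

end Summit.HodgeConjecture.HodgeConjecture.Theorems.MarkmanPartnerTransport.CmAnchorSpread

end
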